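import Summits.BirchSwinnertonDyer.Rank1Residual.O5.O5UncleanParity
import Literature.NumberTheory.EllipticCurves.Rank1Residual.Typed.Basic
import HarnessLib

/-!
# O5 at `p = 3`: the certificate-grade Selmer transfer T27 (o5-r1 GEN 10)

HONEST FRAMING (cell `b2b-bsdres`, class O5 = `9 ∥ N`, tame potentially supersingular, rank 0; lane CLASS-CLOSURE,
experiment types (2) obstruction anatomy and (3) transport lemmas): research route; no claim beyond the stated classes;
census numbers quoted in docstrings are EVIDENCE, never Literature facts; nothing here moves a RESIDUAL-MAP mark; no main
conjecture is used.  Written statement, proofs of the classical steps and the census P-K16 (pre-registered, sha16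
`a8d91a6a65892639`): `run/shared/lean/b2b/bsd-rank1-residual/b2b-bsdres-o5-r1/gen10/T27-TRANSFER-CERTIFICATE.md`.

## What T27 is

GEN 8's disparity budget T25♯ (`SelmerDisparityBudgetThree`, this directory's `O5UncleanParity.lean`) compares the two
mod-3 Selmer groups of a congruent pair `W[3] ≅ G[3]` inside `H¹(ℚ, ρ̄)`; its budget uses the universal Kummer lines at
`3` (T19–T22) and the exact transversality law Thm 7 (b)(c) — THEOREM-CANDIDATES.  T27 is the part of T25♯ whose inputs
are PUBLISHED / classical only:

* the relaxed-Selmer device of Mazur–Rubin, *Selmer companion curves*, Trans. AMS 367 (2015) §7.3 (near-companion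
  theorem: `Sel ⊂ Sel^Σ` with index bounded by `∏_{v ∈ Σ} #H¹(K_v, E[p^k])`) [cite: MazurRubin2015SelmerCompanions, §7.3 (arXiv:1203.0620 p. 13)];
* `#E(ℚ_ℓ)/3E(ℚ_ℓ) = #E(ℚ_ℓ)[3]` for `ℓ ≠ 3` and `= 3 · #E(ℚ₃)[3]` at `3`; `E₀(ℚ_ℓ^{ur})` is 3-divisible (`ℓ ≠ 3`), so the
  Kummer image of `E₀(ℚ_ℓ)` is unramified and `dim F_ℓ(E)/(F_ℓ(E) ∩ H¹_ur) ≤ dim_𝔽₃ Φ_ℓ(𝔽_ℓ)/3 = [3 ∣ c_ℓ(E)]`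
  (the EASY half of GEN 8 Thm 7 (b)); `dim H¹_ur(ℚ_ℓ, ρ̄) = h⁰_ℓ`;
* (grade α⁺ only) at a prime `ℓ ≠ 3` where BOTH curves are split multiplicative with `3 ∣ v_ℓ(Δ)` and `h⁰_ℓ = 1`: the
  Tate curve shows `F_ℓ ≠ H¹_ur` on both sides, Kummer images and `H¹_ur` are self-annihilating for the (symmetric)
  local Tate pairing, and a hyperbolic 𝔽₃-plane has exactly two isotropic lines (`hyperbolicPlaneThree_isotropic_card`,
  PROVED in `O5UncleanParity.lean`) — so `F_ℓ(W) = F_ℓ(G)` there.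

Statement (T27, grade α⁺): for `φ : G[3] ≅ W[3]` with `W[3]` irreducible,
`|dim Sel₃(W) − dim Sel₃(G)| ≤ D(W,G) := (1 + h⁰₃) + #(T(W) ∆ T(G)) + #{ℓ ∈ T(W) ∩ T(G) : h⁰_ℓ = 1, not both split
multiplicative} + 2·#{ℓ ∈ T(W) ∩ T(G) : h⁰_ℓ = 2}`, `T(E)` = `transversePrimesThree E` = `{ℓ ≠ 3 : 3 ∣ c_ℓ(E)}`.
No `ClassO5`, no `LocIrr`, no Kummer-line input: the prime `3` is simply RELAXED (cost `dim E(ℚ₃)/3 = 1 + h⁰₃`).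

B-facing readings (THEOREM-CANDIDATES given T27 + Gross–Zagier–Kolyvagin at `r_an = 0` + Cassels–Tate):
LOWER — a companion with `rank G ≥ D + 1` forces `dim Sel₃(W) ≥ 1`, hence `≥ 2` by parity, hence `9 ∣ #Ш(W)`;
UPPER — a companion with `Sel₃(G) = 0` PROVED and `D ≤ 1` forces `Sel₃(W) = 0`, hence `3 ∤ #Ш(W)`.

## Contents

* §1 (PROVED, sorry-free): the abstract transport lemma over any field — for localisation data
  `loc v : H →ₗ L v` and two families of local conditions `X v`, `Y v` agreeing (`X v ≤ Y v`) outside a finite `S`,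
  `dim Sel_X ≤ dim (Sel_X ∩ Sel_Y) + Σ_{v ∈ S} dim X_v/(X_v ∩ Y_v)` (`finrank_selmerOf_le_inf_add_sum`) and
  `dim Sel_X ≤ dim Sel_Y + Σ_{v ∈ S} dim X_v/(X_v ∩ Y_v)` (`finrank_selmerOf_le_add_sum`), with the local codimension
  identity `finrank_map_mkQ_add_finrank_inf`; bundled as `TransferDatum` with `TransferDatum.dimX_le_and_dimY_le`.
  This is the kernel object provers instantiate (Mazur–Rubin's relaxed Selmer sequence in typed form; KMR 2013 Thm 3.9
  in this tree is the PARITY of the same sum).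
* §2 vocabulary with bodies (census-decidable): `threeAdicH0Bit`, `IsSplitNodeAt`, `crudeBudgetThree` (= `D` above).
* §3 nodes (`@[conjecture] def`, THEOREM-CANDIDATES with written classical proofs): `CrudeSelmerTransferThree` (T27),
  its arithmetic half `SelmerPairRealisedThree` ("the two Selmer groups ARE a transfer datum over `𝔽₃` with local
  codimension sums `≤ D`") with the PROVED implication `crudeSelmerTransferThree_of_realised`, and the B-facing
  `CrudeTransferLowerNineThree` (LOWER), `CrudeTransferUpperUnitThree` (UPPER).
* §4 (PROVED): the numeric skeletons of LOWER / UPPER (`two_le_selmerDim_of_transfer`, `selmerDim_eq_zero_of_transfer`)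
  — exactly what is left once T27, Kummer injectivity `rank ≤ dim Sel₃`, and the parity `dim Sel₃(W) even` are supplied.

Evidence (P-K16, EVIDENCE only; see the md for the table of record): registered falsifier K1 (two-sided BSD-read Selmer
intervals against `D` on every screened congruent pair of the O5@3 universe) and the reach arms A / U / T / C.

Audit advisories (as in GEN 5 / 7 / 8): `IsSplitNodeAt` is an untagged predicate WITH A BODY (census-decidable vocabulary —
the audit files every untagged `def : Prop` under 'vendored-fact'; nothing is assumed about it), and the §1 codimension
helpers / §4 numeric skeletons are 'orphan' until a consumer (the realisation proof, A-O5-25) imports them.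

TYPER PLACEMENT NOTE (cc-typer-5 GEN 10, typer of record O5 §3.5, 2026-08-21; ask A-O5-23, `HOME/INBOX.md` o5-r1 GEN 10
line 2026-08-21T20:13Z). HONEST FRAMING as above and in every file of the cell (lane CLASS-CLOSURE §3.5, deliverables
(c) TRANSPORT — T27 is a COMPARISON STATEMENT along a mod-3 congruence with PUBLISHED antecedents only (Mazur–Rubin 2015
§7.3 relaxed-Selmer device; Tate curve; `E₀(ℚ_ℓ^{ur})` 3-divisible) — and (2) OBSTRUCTION ANATOMY (arms A / U / T and
the irreducible core 508 of the 2 769 open O5@3 r0 X4 rows, EVIDENCE): research route; census = EVIDENCE with a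
PRE-REGISTERED falsifier (P-K16, `gen10/P-K16-PREREG.md` sha16 `a8d91a6a65892639`, frozen 19:46Z BEFORE the run);
nothing booked; no mark of `RESIDUAL-MAP.md` moves; NO Literature fact minted). PROVENANCE: module text above this note
and EVERY declaration below = o5-r1 GEN 10's `HOME/b2b-bsdres-o5-r1/gen10/O5TransferCertificate.lean` (sha16
`7432e5d8310365bd`, 366 l., farm rc 0 / 0 warnings / 0 sorries / axioms standard; write-up
`gen10/T27-TRANSFER-CERTIFICATE.md` `9a8d753432e6867c`), BYTE-IDENTICAL; the only typer changes are this note and two one-line docstrings the gate's `lint.docstring` requires (`mem_selmerOf_iff`, `transferMap_apply_coe`). DEDUP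
re-run (tree grep on all 14 top-level names + the `SelmerTransfer.*` namespace: no match); vocabulary reused, not
re-declared: GEN 8's `transversePrimesThree` / `selmerDimThree` / `FullLocalThreeTorsionAt` / `NoLocalThreeTorsionAt` /
`hyperbolicPlaneThree_isotropic_card` (`O5UncleanParity.lean`), GEN 7's `IsCongruentModThree`, Literature's
`mordellWeilRank` / `ShaFinite` / `shaOrder` / `analyticRank` (through `Rank1Residual.Typed.Basic`'s imports). Bib keys
`MazurRubin2015SelmerCompanions`, `SilvermanATAEC1994` present. AUDIT: `crudeSelmerTransferThree_of_realised` is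
classified 'proof-of-item' of T27 — it is T27 ⇐ T27-REAL (`SelmerPairRealisedThree`, itself an `@[conjecture]`
obligation, A-O5-25 = the one prover step); nothing is discharged unconditionally and both tags stay. PAGE-CHECK
F-T27-1 (harvest-2 GEN 45 E99 `HOME/b2b-bsdres-harvest-2/gen45/E99-F-T27-1-page-check.md` 1aea0fbeab2fb00f, DELIVERED —
PASS AS USED): (1) ATAEC IV Cor. 9.2 + Rem. 9.3 + 9.4 ⇒ the 3-part of `Φ_ℓ(𝔽_ℓ)` is CYCLIC, `dim Φ/3 = [3 ∣ c_ℓ]`;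
(2) AEC VII.2.1 / VII.2.2 / VII.6.1; (3) Poonen–Rains 2012 Prop. 4.11 (any local field) and, for the off-`S` claim
`X_v = Y_v = H¹_ur`, **Prop. 4.13 + Rem. 4.12**; (4) Milne ADT I.2.6 — exact annihilators **for `M` UNRAMIFIED at `v`**
(holds wherever L4 applies and off `S`); (5) Mazur–Rubin arXiv:1203.0620 **Lemma 20 (arXiv numbering, §5.1)** — at
`p = 3`: `dim X_ℓ ≤ t_ℓ` at an additive `ℓ` — and **Lemma 23** (split multiplicative Kummer image) for L4's ramified
uniformiser step. READING: no gap. (cc-typer-5 GEN 10 restamp 1, DOC-ONLY locators; statements byte-identical.) CHECK STATUS at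
landing: F-T27-1 (harvest-2 page-check of the L3/L4 sources) requested in the same line, NOT yet delivered; per-row
certificates A-O5-24 (cc-eng-2 / o5-r2) are instrumentation; a doc-only amendment follows if either returns precisions.
-/

noncomputable section

open scoped Classical

open Module WeierstrassCurve Literature.NumberTheory.EllipticCurves
  Summit.BirchSwinnertonDyer.Rank1Residual.Additive

namespace Summit.BirchSwinnertonDyer.Rank1Residual.O5

/-! ## §1 The abstract transport lemma (PROVED) -/

namespace SelmerTransfer

variable {F : Type*} [Field F] {ι : Type*} {H : Type*} [AddCommGroup H] [Module F H]
  {L : ι → Type*} [∀ v, AddCommGroup (L v)] [∀ v, Module F (L v)]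

/-- The Selmer group cut out of the global space `H` by local conditions `X v ≤ L v` under the localisation maps
`loc v` (KMR 2013 Def. 3.8 / Mazur–Rubin 2015 Def. 2.1 shape): `{c ∈ H : loc v c ∈ X v for every v}`.
[cite: MazurRubin2015SelmerCompanions, §2 (arXiv:1203.0620)] -/
def selmerOf (loc : ∀ v, H →ₗ[F] L v) (X : ∀ v, Submodule F (L v)) : Submodule F H :=
  ⨅ v, (X v).comap (loc v)

variable (loc : ∀ v, H →ₗ[F] L v)

/-- Membership in `selmerOf`: every localisation lands in its local condition. [folklore] -/
@[simp] theorem mem_selmerOf_iff (X : ∀ v, Submodule F (L v)) (c : H) :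
    c ∈ selmerOf loc X ↔ ∀ v, loc v c ∈ X v := by
  simp [selmerOf, Submodule.mem_iInf]

/-- The comparison map `Sel_X → ⊕_{v ∈ S} X_v/(X_v ∩ Y_v)`, the quotient rendered as the image of `X v` in `L v ⧸ Y v`.
[cite: MazurRubin2015SelmerCompanions, §7.3 proof of the near-companion theorem] -/
def transferMap (X Y : ∀ v, Submodule F (L v)) (S : Finset ι) :
    selmerOf loc X →ₗ[F] (∀ v : S, (X v.1).map (Y v.1).mkQ) where
  toFun c := fun v => ⟨(Y v.1).mkQ (loc v.1 (c : H)),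
    Submodule.mem_map_of_mem ((mem_selmerOf_iff loc X (c : H)).mp c.2 v.1)⟩
  map_add' a b := by
    ext v
    simp
  map_smul' r a := by
    ext v
    simp

/-- The `v`-component of `transferMap` is the class of `loc v c` modulo `Y v`. [folklore] -/
theorem transferMap_apply_coe (X Y : ∀ v, Submodule F (L v)) (S : Finset ι) (c : selmerOf loc X) (v : S) :
    ((transferMap loc X Y S c v : (X v.1).map (Y v.1).mkQ) : L v.1 ⧸ Y v.1) = (Y v.1).mkQ (loc v.1 (c : H)) := rfl

/-- The kernel of the comparison map lies in `Sel_X ∩ Sel_Y` when `X v ≤ Y v` off `S`. -/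
theorem ker_transferMap_le (X Y : ∀ v, Submodule F (L v)) (S : Finset ι) (hXY : ∀ v, v ∉ S → X v ≤ Y v) :
    LinearMap.ker (transferMap loc X Y S) ≤ (selmerOf loc X ⊓ selmerOf loc Y).comap (selmerOf loc X).subtype := by
  intro c hc
  rw [LinearMap.mem_ker] at hc
  simp only [Submodule.mem_comap, Submodule.subtype_apply, Submodule.mem_inf]
  refine ⟨c.2, (mem_selmerOf_iff loc Y (c : H)).mpr fun v => ?_⟩
  by_cases hv : v ∈ S
  · have h1 : ((transferMap loc X Y S c ⟨v, hv⟩ : (X v).map (Y v).mkQ) : L v ⧸ Y v) = 0 := by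
      rw [hc]; rfl
    rw [transferMap_apply_coe] at h1
    simpa [Submodule.mkQ_apply] using h1
  · exact hXY v hv ((mem_selmerOf_iff loc X (c : H)).mp c.2 v)

/-- **Transport lemma, intersection form**: `dim Sel_X ≤ dim (Sel_X ∩ Sel_Y) + Σ_{v ∈ S} dim X_v/(X_v ∩ Y_v)` whenever the
local conditions satisfy `X v ≤ Y v` outside the finite set `S` (rank–nullity for `transferMap`).
[cite: MazurRubin2015SelmerCompanions, §7.3] -/
theorem finrank_selmerOf_le_inf_add_sum (X Y : ∀ v, Submodule F (L v)) (S : Finset ι)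
    (hXY : ∀ v, v ∉ S → X v ≤ Y v) [FiniteDimensional F (selmerOf loc X)] [∀ v, FiniteDimensional F (L v)] :
    finrank F (selmerOf loc X) ≤
      finrank F ↥(selmerOf loc X ⊓ selmerOf loc Y) + ∑ v ∈ S, finrank F ((X v).map (Y v).mkQ) := by
  have hrn := LinearMap.finrank_range_add_finrank_ker (transferMap loc X Y S)
  have hker : finrank F (LinearMap.ker (transferMap loc X Y S)) ≤ finrank F ↥(selmerOf loc X ⊓ selmerOf loc Y) :=
    calc finrank F (LinearMap.ker (transferMap loc X Y S))
        ≤ finrank F ((selmerOf loc X ⊓ selmerOf loc Y).comap (selmerOf loc X).subtype) :=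
          Submodule.finrank_mono (ker_transferMap_le loc X Y S hXY)
      _ = finrank F ↥(selmerOf loc X ⊓ selmerOf loc Y) :=
          (Submodule.comapSubtypeEquivOfLe (inf_le_left : selmerOf loc X ⊓ selmerOf loc Y ≤ selmerOf loc X)).finrank_eq
  have hrange : finrank F (LinearMap.range (transferMap loc X Y S)) ≤ ∑ v ∈ S, finrank F ((X v).map (Y v).mkQ) :=
    calc finrank F (LinearMap.range (transferMap loc X Y S))
        ≤ finrank F (∀ v : S, (X v.1).map (Y v.1).mkQ) := Submodule.finrank_le _
      _ = ∑ v : S, finrank F ((X v.1).map (Y v.1).mkQ) := Module.finrank_pi_fintype F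
      _ = ∑ v ∈ S, finrank F ((X v).map (Y v).mkQ) := Finset.sum_coe_sort S (fun v => finrank F ((X v).map (Y v).mkQ))
  omega

/-- **Transport lemma, one-sided form** (the shape T27 uses): `dim Sel_X ≤ dim Sel_Y + Σ_{v ∈ S} dim X_v/(X_v ∩ Y_v)`.
[cite: MazurRubin2015SelmerCompanions, §7.3] -/
theorem finrank_selmerOf_le_add_sum (X Y : ∀ v, Submodule F (L v)) (S : Finset ι)
    (hXY : ∀ v, v ∉ S → X v ≤ Y v) [FiniteDimensional F (selmerOf loc X)] [FiniteDimensional F (selmerOf loc Y)]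
    [∀ v, FiniteDimensional F (L v)] :
    finrank F (selmerOf loc X) ≤ finrank F (selmerOf loc Y) + ∑ v ∈ S, finrank F ((X v).map (Y v).mkQ) := by
  have h1 := finrank_selmerOf_le_inf_add_sum loc X Y S hXY
  have h2 : finrank F ↥(selmerOf loc X ⊓ selmerOf loc Y) ≤ finrank F (selmerOf loc Y) :=
    calc finrank F ↥(selmerOf loc X ⊓ selmerOf loc Y)
        = finrank F ((selmerOf loc X ⊓ selmerOf loc Y).comap (selmerOf loc Y).subtype) :=
          (Submodule.comapSubtypeEquivOfLe (inf_le_right : selmerOf loc X ⊓ selmerOf loc Y ≤ selmerOf loc Y)).finrank_eq.symm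
      _ ≤ finrank F (selmerOf loc Y) := Submodule.finrank_le _
  omega

omit [AddCommGroup H] [Module F H] in
/-- The local codimension identity: `dim X/(X ∩ Y) + dim (X ∩ Y) = dim X`, with `X/(X ∩ Y)` rendered as the image of
`X` in `V ⧸ Y`.  (So each local term of the transport lemma is `dim X_v − dim (X_v ∩ Y_v) ≤ dim X_v`, and vanishes
when `X_v ≤ Y_v`.) [folklore] -/
theorem finrank_map_mkQ_add_finrank_inf {V : Type*} [AddCommGroup V] [Module F V] (X Y : Submodule F V)
    [FiniteDimensional F X] : finrank F (X.map Y.mkQ) + finrank F ↥(X ⊓ Y) = finrank F X := by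
  have h := LinearMap.finrank_range_add_finrank_ker (Y.mkQ.domRestrict X)
  have hr : LinearMap.range (Y.mkQ.domRestrict X) = X.map Y.mkQ := by
    show LinearMap.range (Y.mkQ.comp X.subtype) = _
    rw [LinearMap.range_comp, Submodule.range_subtype]
  have hk : LinearMap.ker (Y.mkQ.domRestrict X) = (X ⊓ Y).comap X.subtype := by
    show LinearMap.ker (Y.mkQ.comp X.subtype) = _
    rw [LinearMap.ker_comp, Submodule.ker_mkQ, Submodule.comap_inf, Submodule.comap_subtype_self, top_inf_eq]
  rw [hr, hk, (Submodule.comapSubtypeEquivOfLe (inf_le_left : X ⊓ Y ≤ X)).finrank_eq] at h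
  exact h

omit [AddCommGroup H] [Module F H] in
/-- Each local term is at most `dim X_v` (the Mazur–Rubin crude constant) … [folklore] -/
theorem finrank_map_mkQ_le {V : Type*} [AddCommGroup V] [Module F V] (X Y : Submodule F V)
    [FiniteDimensional F X] : finrank F (X.map Y.mkQ) ≤ finrank F X := by
  have := finrank_map_mkQ_add_finrank_inf (F := F) X Y
  omega

omit [AddCommGroup H] [Module F H] in
/-- … and vanishes where the two local conditions agree (`X_v ≤ Y_v`). [folklore] -/
theorem finrank_map_mkQ_eq_zero_of_le {V : Type*} [AddCommGroup V] [Module F V] {X Y : Submodule F V}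
    (h : X ≤ Y) : finrank F (X.map Y.mkQ) = 0 := by
  have hbot : X.map Y.mkQ = ⊥ := by
    rw [eq_bot_iff]
    rintro _ ⟨x, hx, rfl⟩
    simpa [Submodule.mkQ_apply] using h hx
  rw [hbot, finrank_bot]

/-! ### Bundled localisation data (the object a prover instantiates with `H¹(ℚ, ρ̄)`, `H¹(ℚ_v, ρ̄)`, the Kummer conditions) -/

/-- **Transfer datum**: a global `F`-space `H`, local spaces `L v` with localisation maps, two families of local
conditions `X v`, `Y v` that are EQUAL outside a finite set `S` of places, with finite Selmer groups and finite local
spaces.  For T27: `F = 𝔽₃`, `H = H¹(ℚ, ρ̄)`, `L v = H¹(ℚ_v, ρ̄)`, `X = F(W)`, `Y = φ_* F(G)`, `S = {3} ∪ primes(N_W N_G)`.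
[cite: MazurRubin2015SelmerCompanions, §2 and §7.3] -/
structure TransferDatum (F : Type) [Field F] where
  /-- index type of places -/
  ι : Type
  /-- the global cohomology space -/
  H : Type
  [instH : AddCommGroup H]
  [modH : Module F H]
  /-- the local cohomology spaces -/
  L : ι → Type
  [instL : ∀ v, AddCommGroup (L v)]
  [modL : ∀ v, Module F (L v)]
  /-- localisation maps -/
  loc : ∀ v, H →ₗ[F] L v
  /-- first family of local conditions -/
  X : ∀ v, Submodule F (L v)
  /-- second family of local conditions -/
  Y : ∀ v, Submodule F (L v)
  /-- the finite exceptional set -/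
  S : Finset ι
  agree : ∀ v, v ∉ S → X v = Y v
  [finX : FiniteDimensional F (selmerOf loc X)]
  [finY : FiniteDimensional F (selmerOf loc Y)]
  [finL : ∀ v, FiniteDimensional F (L v)]

namespace TransferDatum

attribute [instance] instH modH instL modL finX finY finL

variable {F' : Type} [Field F'] (𝓓 : TransferDatum F')

/-- `Σ_{v ∈ S} dim X_v/(X_v ∩ Y_v)`. -/
def budgetXY : ℕ := ∑ v ∈ 𝓓.S, finrank F' ((𝓓.X v).map (𝓓.Y v).mkQ)

/-- `Σ_{v ∈ S} dim Y_v/(X_v ∩ Y_v)`. -/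
def budgetYX : ℕ := ∑ v ∈ 𝓓.S, finrank F' ((𝓓.Y v).map (𝓓.X v).mkQ)

/-- `dim Sel_X`. -/
def dimX : ℕ := finrank F' (selmerOf 𝓓.loc 𝓓.X)

/-- `dim Sel_Y`. -/
def dimY : ℕ := finrank F' (selmerOf 𝓓.loc 𝓓.Y)

/-- **The two-sided transport inequality for a transfer datum** (PROVED from `finrank_selmerOf_le_add_sum`):
`dim Sel_X ≤ dim Sel_Y + Σ dim X_v/(X_v ∩ Y_v)` and symmetrically. [cite: MazurRubin2015SelmerCompanions, §7.3] -/
theorem dimX_le_and_dimY_le : 𝓓.dimX ≤ 𝓓.dimY + 𝓓.budgetXY ∧ 𝓓.dimY ≤ 𝓓.dimX + 𝓓.budgetYX :=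
  ⟨finrank_selmerOf_le_add_sum 𝓓.loc 𝓓.X 𝓓.Y 𝓓.S (fun v hv => (𝓓.agree v hv).le),
    finrank_selmerOf_le_add_sum 𝓓.loc 𝓓.Y 𝓓.X 𝓓.S (fun v hv => (𝓓.agree v hv).ge)⟩

end TransferDatum

end SelmerTransfer

/-! ## §2 Vocabulary (census-decidable, with bodies) -/

/-- The 3-adic bit `h⁰₃ := [W(ℚ₃)[3] ≠ 0]` (for `W` additive at `3`, `dim W(ℚ₃)[3] ≤ 1` because `Ê(3ℤ₃)` is torsion-free and
`#Ẽ_ns(𝔽₃)·c₃ ∈ {3, 6, 12}`; on `LocIrr` rows it is `0`).  Census: `local_h0` at `ℓ = 3`. [folklore] -/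
noncomputable def threeAdicH0Bit (W : WeierstrassCurve ℚ) : ℕ :=
  if @NoLocalThreeTorsionAt W 3 ⟨Nat.prime_three⟩ then 0 else 1

/-- **Split multiplicative reduction at `ℓ`** read off the globally minimal model: `c₄ ≠ 0` with `v_ℓ(c₄) = 0 < v_ℓ(Δ)`
(a node: `c₄ ≠ 0` guards the junk value `padicValRat ℓ 0 = 0` on `j = 0` curves) and `−c₆` is a square in `ℚ_ℓ^×`
(Tate: `E ≅ E_q` over `ℚ_ℓ` iff `−c₄/c₆ ∈ (ℚ_ℓ^×)²`, and `c₄ ≡ 1 (mod 8q)` is a square at a node; valid at `ℓ = 2` as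
well: `−c₆(E_q) ≡ 1 (mod 8)`).  Census: pk12_lib `local_data` (`legendre(−c₆, ℓ)`).  This is OUR census predicate (a definition with a
body, not a vendored fact); the split/non-split criterion it encodes is Silverman, ATAEC, Thm. V.5.3 (bib key
SilvermanATAEC1994). [folklore] -/
def IsSplitNodeAt (W : WeierstrassCurve ℚ) (ℓ : ℕ) [Fact ℓ.Prime] : Prop :=
  W.c₄ ≠ 0 ∧ padicValRat ℓ W.c₄ = 0 ∧ 0 < padicValRat ℓ W.Δ ∧ ∃ s : ℚ_[ℓ], s ≠ 0 ∧ ((-W.c₆ : ℚ) : ℚ_[ℓ]) = s ^ 2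

/-- **The crude (grade α⁺) budget `D(W,G)`** of T27: the relaxed prime `3` costs `1 + h⁰₃`; a prime `ℓ ≠ 3` with `3 ∣ c_ℓ`
on exactly one side costs `1`; on both sides it costs `h⁰_ℓ ∈ {1, 2}`, except that a shared SPLIT-MULTIPLICATIVE
transverse prime with `h⁰_ℓ = 1` costs `0` (Tate curve + two isotropic lines).  Every other prime costs `0`.  An upper
bound for `Σ_v dim F_v(W)/(F_v(W) ∩ F_v(G))` by the classical local facts listed in the module docstring. [folklore] -/
noncomputable def crudeBudgetThree (W G : WeierstrassCurve ℚ) [W.IsElliptic] [W.IsGloballyMinimal]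
    [G.IsElliptic] [G.IsGloballyMinimal] : ℕ :=
  (1 + threeAdicH0Bit W) + (symmDiff (transversePrimesThree W) (transversePrimesThree G)).ncard +
    {ℓ ∈ transversePrimesThree W ∩ transversePrimesThree G |
        ∃ hℓ : ℓ.Prime, ¬ @FullLocalThreeTorsionAt W ℓ ⟨hℓ⟩ ∧ ¬ (@IsSplitNodeAt W ℓ ⟨hℓ⟩ ∧ @IsSplitNodeAt G ℓ ⟨hℓ⟩)}.ncard +
    2 * {ℓ ∈ transversePrimesThree W ∩ transversePrimesThree G | ∃ hℓ : ℓ.Prime, @FullLocalThreeTorsionAt W ℓ ⟨hℓ⟩}.ncard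

/-! ## §3 Nodes (THEOREM-CANDIDATES; proofs written in T27-TRANSFER-CERTIFICATE.md §1–§2, classical inputs only) -/

/-- **T27 `CrudeSelmerTransferThree` (THEOREM-CANDIDATE, o5-r1 GEN 10; grade α⁺ = published / classical inputs only).**
For `W, G / ℚ` with `W[3]` irreducible and `a_ℓ(W) ≡ a_ℓ(G) (mod 3)` away from `3 N_W N_G` (so `ρ̄_W ≅ ρ̄_G` by
Brauer–Nesbitt–Chebotarev), the two 3-Selmer groups inside `H¹(ℚ, ρ̄)` satisfy
`|dim Sel₃(W) − dim Sel₃(G)| ≤ D(W,G)` = `crudeBudgetThree W G`.  Proof: §1 (`finrank_selmerOf_le_add_sum`) with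
`S = {3} ∪ primes(N_W N_G)`, `X = F(W)`, `Y = F(G)` (equal unramified conditions at good primes, `H¹(ℝ, ρ̄) = 0`), and
the local bounds of the module docstring.  NO `ClassO5`, `LocIrr` or Kummer-line (T19–T22) hypothesis.  Why it might
fail: only through the vocabulary (`PDvdTamagawaAt`, `Full/NoLocalThreeTorsionAt`, `IsSplitNodeAt` at `ℓ = 2`) not
matching the classical objects it names.
[evidence: census cell O5, o5-r1 GEN 10, P-K16 K1: two-sided BSD-read Selmer intervals `[r + 2·[9 ∣ Ш_an], r + v₃ Ш_an]` against `D` on every screened congruent pair of the O5@3 universe — table of record in T27-TRANSFER-CERTIFICATE.md §4] -/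
@[conjecture] def CrudeSelmerTransferThree : Prop :=
  ∀ (W G : WeierstrassCurve ℚ) [W.IsElliptic] [W.IsGloballyMinimal] [G.IsElliptic] [G.IsGloballyMinimal],
    W.HasIrreducibleModPGaloisRep 3 → IsCongruentModThree W G →
      selmerDimThree W ≤ selmerDimThree G + crudeBudgetThree W G ∧
        selmerDimThree G ≤ selmerDimThree W + crudeBudgetThree W G

/-- **T27-REAL `SelmerPairRealisedThree` (THEOREM-CANDIDATE, o5-r1 GEN 10): the arithmetic half of T27.**  For a mod-3
congruent pair with `W[3]` irreducible there is a transfer datum over `𝔽₃` (global space `H¹(ℚ, ρ̄)`, local spaces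
`H¹(ℚ_v, ρ̄)`, `X = ` Kummer conditions of `W`, `Y = φ_*` Kummer conditions of `G`, `S = {3} ∪ primes(N_W N_G)`; equal
unramified conditions off `S`) whose two Selmer dimensions are `dim Sel₃(W)`, `dim Sel₃(G)` and whose two local
codimension sums are `≤ D(W,G)`.  The local bounds: `dim X₃ = dim W(ℚ₃)/3 = 1 + h⁰₃`; for `ℓ ≠ 3`,
`dim X_ℓ/(X_ℓ ∩ H¹_ur) ≤ [3 ∣ c_ℓ]` (`E₀(ℚ_ℓ^ur)` 3-divisible), `dim H¹_ur = dim X_ℓ = h⁰_ℓ`, and `X_ℓ = Y_ℓ` at a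
shared split node with `h⁰_ℓ = 1` (Tate curve + `hyperbolicPlaneThree_isotropic_card`).  Why it might fail: only
through the vocabulary (as for T27).  With it, T27 is PROVED (`crudeSelmerTransferThree_of_realised`).
[evidence: census cell O5, o5-r1 GEN 10, P-K16 K1 (as for `CrudeSelmerTransferThree`) — T27-TRANSFER-CERTIFICATE.md §4] -/
@[conjecture] def SelmerPairRealisedThree : Prop :=
  ∀ (W G : WeierstrassCurve ℚ) [W.IsElliptic] [W.IsGloballyMinimal] [G.IsElliptic] [G.IsGloballyMinimal],
    W.HasIrreducibleModPGaloisRep 3 → IsCongruentModThree W G →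
      ∃ 𝓓 : SelmerTransfer.TransferDatum (ZMod 3),
        𝓓.dimX = selmerDimThree W ∧ 𝓓.dimY = selmerDimThree G ∧
          𝓓.budgetXY ≤ crudeBudgetThree W G ∧ 𝓓.budgetYX ≤ crudeBudgetThree W G

/-- **T27 from its arithmetic half** (PROVED): `SelmerPairRealisedThree → CrudeSelmerTransferThree`, by the abstract
transport lemma `TransferDatum.dimX_le_and_dimY_le`. [folklore] -/
theorem crudeSelmerTransferThree_of_realised (h : SelmerPairRealisedThree) : CrudeSelmerTransferThree := by
  intro W G _ _ _ _ hirr hcong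
  obtain ⟨𝓓, hX, hY, hb, hb'⟩ := h W G hirr hcong
  have h2 := 𝓓.dimX_le_and_dimY_le
  omega

/-- **T27-LOWER `CrudeTransferLowerNineThree` (THEOREM-CANDIDATE given T27; B-facing LOWER reading).**  `W` of analytic
rank `0` with `W[3]` irreducible, a mod-3 congruent companion `G` with `rank G ≥ D(W,G) + 1`: then
`dim Sel₃(W) ≥ dim Sel₃(G) − D ≥ rank G − D ≥ 1` (Kummer: `G(ℚ)/3 ↪ Sel₃(G)`), `rank W = 0` and `#Ш(W) < ∞`
(Gross–Zagier–Kolyvagin, tree fact `rank_eq_analyticRank_of_analyticRank_le_one`), `W(ℚ)[3] = 0`, so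
`dim Ш(W)[3] = dim Sel₃(W) ≥ 1` is EVEN (Cassels–Tate, `exists_casselsTate_pairing`) hence `≥ 2`: `9 ∣ #Ш(W)`.
With `v₃(#Ш_an(W)) = 2` and Kato's upper bound at `(W, 3)` this is `BSD₃(W)` (bookkeeping of `Typed.Basic`).  Why it
might fail: only through T27.  Numeric skeleton PROVED below (`two_le_selmerDim_of_transfer`).
[evidence: census cell O5, o5-r1 GEN 10, P-K16 arm A (LOWER9/BOTH rows with a companion of rank ≥ D + 1, deep-screened) — counts in T27-TRANSFER-CERTIFICATE.md §4] -/
@[conjecture] def CrudeTransferLowerNineThree : Prop :=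
  ∀ (W G : WeierstrassCurve ℚ) [W.IsElliptic] [W.IsGloballyMinimal] [G.IsElliptic] [G.IsGloballyMinimal],
    W.HasIrreducibleModPGaloisRep 3 → IsCongruentModThree W G → W.analyticRank = 0 →
      crudeBudgetThree W G + 1 ≤ G.mordellWeilRank → 9 ∣ W.shaOrder

/-- **T27-UPPER `CrudeTransferUpperUnitThree` (THEOREM-CANDIDATE given T27; B-facing UPPER reading).**  `W` of analytic
rank `0` with `W[3]` irreducible, a mod-3 congruent companion `G` with `Sel₃(G) = 0` (typed: rank `0`, `Ш(G)` finite,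
`3 ∤ #Ш(G)`; `G(ℚ)[3] = 0` is automatic) and `D(W,G) ≤ 1`: then `dim Sel₃(W) ≤ 1`, even, so `Sel₃(W) = 0` and
`3 ∤ #Ш(W)` — for a UNIT row (`3 ∤ ∏ c_ℓ · #Ш_an`) this is `BSD₃(W)` outright, with NO image hypothesis on `W` (the
3-adic `SL₂`-certificate is needed for `G` only, or `BSD₃(G)` is known otherwise).  Why it might fail: only through T27.
Numeric skeleton PROVED below (`selmerDim_eq_zero_of_transfer`).
[evidence: census cell O5, o5-r1 GEN 10, P-K16 arm U (UNIT-open rows with a closed rank-0 3-free companion and D ≤ 1, deep-screened) — counts in T27-TRANSFER-CERTIFICATE.md §4] -/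
@[conjecture] def CrudeTransferUpperUnitThree : Prop :=
  ∀ (W G : WeierstrassCurve ℚ) [W.IsElliptic] [W.IsGloballyMinimal] [G.IsElliptic] [G.IsGloballyMinimal],
    W.HasIrreducibleModPGaloisRep 3 → IsCongruentModThree W G → W.analyticRank = 0 →
      G.mordellWeilRank = 0 → G.ShaFinite → ¬ 3 ∣ G.shaOrder →
      crudeBudgetThree W G ≤ 1 → ¬ 3 ∣ W.shaOrder

/-! ## §4 Numeric skeletons (PROVED): what is left once T27, Kummer injectivity and parity are supplied -/

/-- LOWER skeleton: transfer `sG ≤ sW + D`, Kummer `rG ≤ sG`, the companion inequality `D + 1 ≤ rG`, and parity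
`Even sW` (rank `0`, no rational 3-torsion, `dim Ш[3]` even) give `2 ≤ sW`. [folklore] -/
theorem two_le_selmerDim_of_transfer {sW sG rG D : ℕ} (hT : sG ≤ sW + D) (hK : rG ≤ sG) (hr : D + 1 ≤ rG)
    (hpar : Even sW) : 2 ≤ sW := by
  obtain ⟨k, hk⟩ := hpar
  omega

/-- UPPER skeleton: transfer `sW ≤ sG + D`, `sG = 0`, `D ≤ 1` and parity `Even sW` give `sW = 0`. [folklore] -/
theorem selmerDim_eq_zero_of_transfer {sW sG D : ℕ} (hT : sW ≤ sG + D) (hG : sG = 0) (hD : D ≤ 1)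
    (hpar : Even sW) : sW = 0 := by
  obtain ⟨k, hk⟩ := hpar
  omega

/-- LOWER skeleton, graded: more generally `sW ≥ rG − D` rounded UP to an even number —
`2 * ((rG - D + 1) / 2) ≤ sW`. [folklore] -/
theorem even_roundup_le_selmerDim_of_transfer {sW sG rG D : ℕ} (hT : sG ≤ sW + D) (hK : rG ≤ sG)
    (hpar : Even sW) : 2 * ((rG - D + 1) / 2) ≤ sW := by
  obtain ⟨k, hk⟩ := hpar
  omega

end Summit.BirchSwinnertonDyer.Rank1Residual.O5

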